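import Literature.MathematicalPhysics.QuantumFieldTheory.Balaban1983to89.Node00.Record13SepCoPR
import Literature.MathematicalPhysics.QuantumFieldTheory.Balaban1983to89.Node00.Record13ResidualsR
import Literature.MathematicalPhysics.QuantumFieldTheory.Balaban1983to89.Node00.Record12BgRowCoClassC1
import Literature.MathematicalPhysics.QuantumFieldTheory.Balaban1983to89.Node00.Record13BgRowAtDatumUPosOfClassC1
import Literature.MathematicalPhysics.QuantumFieldTheory.Balaban1983to89.Node00.Record13ReverseComparabilityOfBetaBox
import Literature.MathematicalPhysics.QuantumFieldTheory.Balaban1983to89.Node00.Record13SepCoPLiveSelector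

/-!
# NODE 00 (YM-PLAN Track A) — STAGE 13, v1.6 `CoPR` (director-ym №169 H1 ∕ №174 PRESS WORD; FINDING №8 = node00-def-T LOCATED-8 «the residual 𝐓-weight slot is run-blind»): THE K0 BODY OF THE
# RUN-INDEXED EDITION FROM THE v1.5 ONE — AT THE CURED PIN `Zr := ZrOfRecord₁₃` (FILE 17: dag-n11-d's diagonal cure as the definition of record; №174 (5) «K0a∕K0b: re-pin `Zr`»), at ANY lawful `Zr`
# (generic lift), and at the run-blind embedding (node00-def-T FILE 25∕26T §R, plan g69 Q4) — with the pointed corollaries over node00-def-K0a's v1.5 socket 16a and closers 16b∕16c∕16d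

Cell `pub-ymgap`, seat `pub-ymgap-node00-def-K0a` (g9), FILE 18.  The v1.6 edition (node00-def-T `Node00/Record13CoPR` + `Node00/Record13SepCoPR`): `structure Stage13RParams extends Stage13Params` with ONE new
field `Zr : (p : B12.RunParams) → TkResidualW Fam N (FluctV N) p.K`; proviso rows `Provisos₁₃SepCoPR` = v1.5 `Provisos₁₃SepCoP`'s VERBATIM at `θ.toStage13Params` except `ztLaws∕ztLocal ↦ zrLaws∕zrLocal`; guard
`ZrUnity`; `SlotsNondegenerate₁₃`∕`Admissible` read through `toStage13Params`.  CONSEQUENCE (this file): every v1.5 K0 inhabitant `θ₀` LIFTS to a v1.6 inhabitant at ANY run-indexed residual `Zr` obeying 12a's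
law and 12b's locality law run by run, with `ZrUnity` the only new obligation — in particular at THE PIN OF RECORD `ZrOfRecord₁₃ F N θ₀` (FILE 17: the three laws are theorems there, unity of def-T's label
residual `θ₀.ζ` being the v1.5 row `zetaUnity`), whence ★★★ `exists_k0SepCoPR_of_exists_k0SepCoP : K0⁵-body(F) → K0⁶-body(F)` with the CURED witness `Stage13RParams.ofCured F N θ₀ := ⟨θ₀, ZrOfRecord₁₃ F N θ₀⟩`
(dag-n11-d's no-expansion diagonal of (S1ᵀ)₁₃ is then dischargeable at the K0 witness family the K1 road is pointed at — the point of FINDING №8; the run-blind embedding `ofRunBlind` (def-T §R) also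
inhabits K0⁶ but owes the unprinted g₀-uniform matching (★) at N11 k = 0, n11-d l.19237).  [III] = [Balaban1988Convergent], [I] = [Balaban1987RG1], [IV] = [Balaban1989LargeFieldI], [6] = [Balaban1985RegularSpaces],
[15] = [Balaban1985Variational].

WHAT THIS FILE DEFINES ∕ PROVES (1 `def`, theorems otherwise).
§1 GENERIC LIFTS at any lawful `Zr`: `Stage13RParams.provisos₁₃CoPR_of_core (h : θ.toStage13Params.Provisos₁₃Core F N) (hL : ∀ p, (θ.Zr p).Laws) (hLoc : ∀ p, (θ.Zr p).LocalLaws) : θ.Provisos₁₃CoPR F N`,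
   `Stage13RParams.provisos₁₃SepCoPR_of_sepCoP (h : θ.toStage13Params.Provisos₁₃SepCoP F N) (hL) (hLoc) : θ.Provisos₁₃SepCoPR F N` (named-field constructors; every non-residual row VERBATIM);
   `exists_k0SepCoPR_of_k0SepCoP_at (θ₀) (hP) (hS) (hA) (Zr) (hL hLoc hU)` (the ⁶ body at `⟨θ₀, Zr⟩`).
§2 THE CURED EMBEDDING `Stage13RParams.ofCured F N θ₀ : Stage13RParams F N := ⟨θ₀, ZrOfRecord₁₃ F N θ₀⟩` (def) + `_toStage13Params`∕`_Zr` (rfl), `Stage13RParams.zrUnity_ofCured` (FILE 17 `finsum_ζ0_ZrOfRecord₁₃`),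
   `admissible_ofCured_iff`∕`slotsNondegenerate₁₃_ofCured_iff` (Iff.rfl), `Stage13Params.Provisos₁₃Core.ofCured`, `Stage13Params.Provisos₁₃SepCoP.ofCured` (rows + FILE 17 `laws_∕localLaws_ZrOfRecord₁₃`, `hζu := h.zetaUnity`),
   `WtOfRecord₁₃R_ofCured` (the run's v1.6 weights at the cured witness = 12a″'s builder over `ZrOfRecord₁₃`, rfl), `WtOfRecord₁₃R_ofCured_ζ` ∕ `_w_empty` and
   ★ `WtOfRecord₁₃R_ofCured_zetaFactor_pairCfgAt (hj : j < p.K)` (dag-n11-d's generation-`j` ζ-SPEC with `c = 1` AT THE CURED WEIGHTS: `ζ_j(T)·w_j(∅,∅,∅)` at `(U, V′)` = `w_j(s′_j(p))(U, Ū)`).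
§3 ★★★ `exists_k0SepCoPR_of_exists_k0SepCoP (F) : (∃ θ : Stage13Params F N, θ.Provisos₁₃SepCoP F N ∧ (θ.ZtUnity F N ∧ θ.SlotsNondegenerate₁₃ F N) ∧ θ.Admissible F N) → ∃ θ : Stage13RParams F N, θ.Provisos₁₃SepCoPR F N ∧ (θ.ZrUnity F N ∧ θ.SlotsNondegenerate₁₃ F N) ∧ θ.Admissible F N` (CURED witness) and its run-blind twin
   `exists_k0SepCoPR_runBlind_of_exists_k0SepCoP` (def-T's `ofRunBlind`; NOT the pin of record).
§4 POINTED COROLLARIES at `N = 2` (one line each over ★★★): `exists_k0SepCoPR_of_bgSepCoP_theta13LiveOfNumerics` (16a socket: the (7)-guarded row P11 at the all-numerics family ALONE), `exists_k0SepCoPR_of_classBounds`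
   (16b Cut A), `exists_k0SepCoPR_of_thm1RegSepCoP7M_of_betaBox` (16c Cut B′: [15] Thm 1 (8) fact + β-box + guarded C¹ clause), `exists_k0SepCoPR_of_thm1RegSepCoP7M_of_thm1C1_of_betaBox` (16d Cut B″: both [15] sentences + β-box).

§4 (the four POINTED COROLLARIES `exists_k0SepCoPR_of_{bgSepCoP_theta13LiveOfNumerics,classBounds,thm1RegSepCoP7M_of_betaBox,thm1RegSepCoP7M_of_thm1C1_of_betaBox}`, 0 tree users) is HOISTED verbatim into the leaf module
`Node00/Record13SepCoPRInhabitedOfSepCoPPointed` (Stage-2 import hygiene, director-ym №343∕№346: this module no longer imports `Record13SepCoPInhabitedOfThm1CoP7M(C1)`, so the at-record readers above `Stage13RParams.ofCured` do not sit in the seam edit's red cone; the four extra imports `Record12BgRowCoClassC1`, `Record13BgRowAtDatumUPosOfClassC1`,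
`Record13ReverseComparabilityOfBetaBox`, `Record13SepCoPLiveSelector` RE-EXPORT the seed-free modules this file used to pass on through those two imports — certifier dag-n07-w2 CERT-2).

HONEST FRAMING.  Structure bookkeeping (named-field constructors, `rfl`∕`Iff.rfl`, one `obtain`); the displayed hypotheses of the corollaries are 16a–16d's VERBATIM (named [15] facts NEVER asserted); nothing of
Bałaban asserted or discharged; K0⁶ NOT closed here (its row P11 ∕ β-box ∕ class-clause hypotheses are exactly K0⁵'s); dag-n11-d's (S1ᵀ)₁₃ diagonal is NOT proved here (their theorems + FILE 17's pin faces, K1 lane);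
counts unmoved (typed 28∕28 · discharged 5∕28); one finite 𝕋⁴ programme at fixed ε — NOT continuum ∕ OS ∕ mass gap ∕ Clay.  No `sorry`, `axiom`, `instance`, `notation`.
-/

noncomputable section

open MeasureTheory
open scoped BigOperators Matrix.Norms.L2Operator

namespace Literature.MathematicalPhysics.QuantumFieldTheory.Balaban1983to89.Node00

open T4Continuum B14.Eq218Concrete B15DeterminingSets FlowStep FlowStepRuns B12RegularSpaces111 B14RegularSpaces234 B14Radii T4AxialGaugeSmallField

/-! ## §1. Generic lifts: the v1.6 provisos ∕ K0 body at ANY lawful run-indexed residual -/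

section GenericLift

variable {F : T4Family} {N : ℕ} [NeZero N]

/-- **THE v1.6 CORE FROM THE v1.5 CORE AT ANY LAWFUL `Zr`** (rows verbatim at `θ.toStage13Params`; `zrLaws ∕ zrLocal` supplied). [cite: Balaban1988Convergent, (2.21) p.258, (3.16) p.268, p.267 (bookkeeping)] -/
theorem Stage13RParams.provisos₁₃CoPR_of_core {θ : Stage13RParams F N} (h : θ.toStage13Params.Provisos₁₃Core F N)
    (hL : ∀ p : B12.RunParams, (θ.Zr p).Laws) (hLoc : ∀ p : B12.RunParams, (θ.Zr p).LocalLaws) : θ.Provisos₁₃CoPR F N where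
  intPiece := h.intPiece
  measω := h.measω
  measChi := h.measChi
  zetaUnity := h.zetaUnity
  zetaAbs := h.zetaAbs
  rstep := fun p k _ hk => h.rstep p k hk
  rzLaws := h.rzLaws
  zrLaws := hL
  zrLocal := hLoc

/-- **THE v1.6 SEPARATED-RANGE PROVISOS FROM THE v1.5 ONES AT ANY LAWFUL `Zr`** (rows verbatim at `θ.toStage13Params` — core rows, the pins `hM`∕`hM₁`, the (7)-guarded row `bg` at
def-R's Co-class background; `zrLaws ∕ zrLocal` supplied).  The one door from every ⁵ K0 storey to ⁶. [cite: Balaban1988Convergent, (2.18) p.257, (2.28) p.259, (3.16) p.268, p.245, p.267 (bookkeeping)] -/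
theorem Stage13RParams.provisos₁₃SepCoPR_of_sepCoP {θ : Stage13RParams F N} (h : θ.toStage13Params.Provisos₁₃SepCoP F N)
    (hL : ∀ p : B12.RunParams, (θ.Zr p).Laws) (hLoc : ∀ p : B12.RunParams, (θ.Zr p).LocalLaws) : θ.Provisos₁₃SepCoPR F N where
  intPiece := h.intPiece
  measω := h.measω
  measChi := h.measChi
  zetaUnity := h.zetaUnity
  zetaAbs := h.zetaAbs
  rstep := fun p k _ hk => h.rstep p k hk
  rzLaws := h.rzLaws
  zrLaws := hL
  zrLocal := hLoc
  hM := h.hM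
  hM₁ := h.hM₁
  bg := h.bg

/-- **THE v1.6 K0 BODY AT `⟨θ₀, Zr⟩` FROM THE v1.5 ROWS AT `θ₀` AND A LAWFUL, UNITY-RESOLVING `Zr`** (the guard `SlotsNondegenerate₁₃` and admissibility read `θ₀`).
[cite: Balaban1988Convergent, Thm 1 p.262, (2.28) p.259, (3.16)–(3.22) pp.268–269 (bookkeeping)] -/
theorem exists_k0SepCoPR_of_k0SepCoP_at (θ₀ : Stage13Params F N) (hP : θ₀.Provisos₁₃SepCoP F N) (hS : θ₀.SlotsNondegenerate₁₃ F N) (hA : θ₀.Admissible F N)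
    (Zr : (p : B12.RunParams) → TkResidualW F N (FluctV N) p.K) (hL : ∀ p, (Zr p).Laws) (hLoc : ∀ p, (Zr p).LocalLaws)
    (hU : ∀ (p : B12.RunParams) (j : ℕ) (ω : Tk.MultiCfg (F.P p.K) (SU N) (FluctV N)), (∑ᶠ Y : Set (Site (F.P p.K) 0), (Zr p).ζ0 j Y ω) = 1) :
    ∃ θ : Stage13RParams F N, θ.Provisos₁₃SepCoPR F N ∧ (θ.ZrUnity F N ∧ θ.SlotsNondegenerate₁₃ F N) ∧ θ.Admissible F N :=
  ⟨⟨θ₀, Zr⟩, Stage13RParams.provisos₁₃SepCoPR_of_sepCoP (θ := ⟨θ₀, Zr⟩) hP hL hLoc, ⟨hU, hS⟩, hA⟩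

end GenericLift

/-! ## §2. The CURED embedding `θ₀ ↦ ⟨θ₀, ZrOfRecord₁₃ θ₀⟩` and its faces -/

section Cured

variable (F : T4Family) (N : ℕ) [NeZero N]

/-- **THE CURED EMBEDDING** (director-ym №174 (5); node00-def-T memo §6): the v1.5 Stage-13 parameter `θ₀` with the run-indexed residual 𝐓-weight slot FILLED BY THE PIN OF RECORD
`ZrOfRecord₁₃ F N θ₀` (FILE 17: dag-n11-d's diagonal cure — at every generation `j < K` of the run, `ζ0_j(T) = w_j(s′_j(p))(V_j, V̄_j)`, complement on `∅`, `quad = 0`).  Contrast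
def-T's `Stage13RParams.ofRunBlind` (`Zr p := θ₀.Zt p.K`). [cite: Balaban1988Convergent, (1.11) p.248, (3.16)–(3.20) pp.268–269, p.267] -/
def Stage13RParams.ofCured (θ₀ : Stage13Params F N) : Stage13RParams F N :=
  ⟨θ₀, ZrOfRecord₁₃ F N θ₀⟩

/-- The cured embedding forgets to the parameter it came from (`rfl`). [cite: Balaban1988Convergent, (3.16) p.268 (bookkeeping)] -/
theorem Stage13RParams.ofCured_toStage13Params (θ₀ : Stage13Params F N) : (Stage13RParams.ofCured F N θ₀).toStage13Params = θ₀ := rfl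

/-- The run-indexed slot of the cured embedding IS the pin of record (`rfl`). [cite: Balaban1988Convergent, (1.11) p.248 (bookkeeping)] -/
theorem Stage13RParams.ofCured_Zr (θ₀ : Stage13Params F N) (p : B12.RunParams) : (Stage13RParams.ofCured F N θ₀).Zr p = ZrOfRecord₁₃ F N θ₀ p := rfl

/-- The run's v1.6 𝐓-weights at the cured embedding are 12a″'s builder over the pin of record (`rfl`). [cite: Balaban1988Convergent, (2.21) p.258, (3.21) p.269 (bookkeeping)] -/
theorem WtOfRecord₁₃R_ofCured (θ₀ : Stage13Params F N) (p : B12.RunParams) :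
    WtOfRecord₁₃R F N (Stage13RParams.ofCured F N θ₀) p = tkWeightsOfRecordP F N (FluctV N) θ₀.ν θ₀.A₁ p (gOfRecord₁₃ F N θ₀ p) (ZrOfRecord₁₃ F N θ₀ p) := rfl

variable {F N}

/-- The `ζ`-field of the run's v1.6 weights at the cured embedding IS the pin's `ζ0` — NO regularity factor (12a″; `rfl`). [cite: Balaban1988Convergent, (1.11) p.248, (2.21) p.258 (bookkeeping)] -/
theorem WtOfRecord₁₃R_ofCured_ζ (θ₀ : Stage13Params F N) (p : B12.RunParams) (j : ℕ) (Y : Set (Site (F.P p.K) 0)) (ω : Tk.MultiCfg (F.P p.K) (SU N) (FluctV N)) :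
    (WtOfRecord₁₃R F N (Stage13RParams.ofCured F N θ₀) p).ζ j Y ω = (ZrOfRecord₁₃ F N θ₀ p).ζ0 j Y ω := rfl

/-- The A-weight of the run's v1.6 weights at the cured embedding at the empty regions is `1` (`χ(∅, ∅) = 1`, `quad = 0`). [cite: Balaban1988Convergent, (2.21)–(2.22) p.258, (3.21) p.269 (bookkeeping)] -/
theorem WtOfRecord₁₃R_ofCured_w_empty (θ₀ : Stage13Params F N) (p : B12.RunParams) (j : ℕ) (ω : Tk.MultiCfg (F.P p.K) (SU N) (FluctV N)) :
    (WtOfRecord₁₃R F N (Stage13RParams.ofCured F N θ₀) p).w j ∅ ∅ ∅ ω = 1 := by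
  show chiAW F N (FluctV N) θ₀.ν θ₀.A₁ p (gOfRecord₁₃ F N θ₀ p) j ∅ ∅ ω * Real.exp (-(1 / 2 : ℝ) * (ZrOfRecord₁₃ F N θ₀ p).quad j ∅ ω) = 1
  rw [chiAW_empty_empty, one_mul, ZrOfRecord₁₃_quad, mul_zero, Real.exp_zero]

/-- **★ THE GENERATION-`j` ζ-SPEC OF dag-n11-d HOLDS WITH CONSTANT `c = 1` AT THE CURED WITNESS's WEIGHTS** (hypothesis (iii) of `slotsT_succ_ae_eq_sect2Slot_of_zetaSpecAt`, and `hζ` of the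
level-1 theorem at `j = 0`): at g3's two-scale configuration `(V_j, V_{j+1}) = (U, V′)` the generation-`j` factor `ζ_j(T)·w_j(∅,∅,∅)` of `WtOfRecord₁₃R (ofCured θ₀) p` IS def-T's resummed step weight of the
ALL-LARGE-FIELD new sequence on the averaging graph, `w_j(s′_j(p))(U, Ū)` (`j < K`).  Bookkeeping on FILE 17's pin faces — the (3.25) identity itself is dag-n11-d's theorem, not claimed here.
[cite: Balaban1988Convergent, (1.11) p.248, (2.21) p.258, (3.24)–(3.25) p.270] -/
theorem WtOfRecord₁₃R_ofCured_zetaFactor_pairCfgAt (θ₀ : Stage13Params F N) (p : B12.RunParams) {j : ℕ} (hj : j < p.K)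
    (V' : GaugeField (F.P p.K) (j + 1) (SU N)) (U : GaugeField (F.P p.K) j (SU N)) :
    (WtOfRecord₁₃R F N (Stage13RParams.ofCured F N θ₀) p).ζ j Set.univ (Tk.pairCfgAt (V := FluctV N) j V' U) *
        (WtOfRecord₁₃R F N (Stage13RParams.ofCured F N θ₀) p).w j ∅ ∅ ∅ (Tk.pairCfgAt (V := FluctV N) j V' U) =
      wOfRecord₉ F N θ₀.toStage9Params p (gOfRecord₁₃ F N θ₀ p) j (seqAllLargeOfRecord F θ₀.ν θ₀.τ9.M (gOfRecord₁₃ F N θ₀ p) p.K (j + 1))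
        U ((avOfRecord F N p.K j).avg U) := by
  rw [WtOfRecord₁₃R_ofCured_w_empty, mul_one, WtOfRecord₁₃R_ofCured_ζ]
  exact ZrOfRecord₁₃_ζ0_univ_pairCfgAt hj V' U

/-- **THE GUARD `ZrUnity` HOLDS AT THE CURED EMBEDDING, hypothesis-free** (FILE 17 `finsum_ζ0_ZrOfRecord₁₃`). [cite: Balaban1988Convergent, (3.16)–(3.20) pp.268–269] -/
theorem Stage13RParams.zrUnity_ofCured (θ₀ : Stage13Params F N) : (Stage13RParams.ofCured F N θ₀).ZrUnity F N :=
  fun p j ω => finsum_ζ0_ZrOfRecord₁₃ (θ := θ₀) (p := p) j ω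

/-- Admissibility at the cured embedding IS `θ₀`'s (`Iff.rfl`). [cite: Balaban1988Convergent, (2.9) p.256 (bookkeeping)] -/
theorem Stage13RParams.admissible_ofCured_iff {θ₀ : Stage13Params F N} : (Stage13RParams.ofCured F N θ₀).Admissible F N ↔ θ₀.Admissible F N := Iff.rfl

/-- Slot non-degeneracy at the cured embedding IS `θ₀`'s (`Iff.rfl`). [cite: Balaban1988Convergent, (2.18) p.257 (bookkeeping)] -/
theorem Stage13RParams.slotsNondegenerate₁₃_ofCured_iff {θ₀ : Stage13Params F N} :
    (Stage13RParams.ofCured F N θ₀).SlotsNondegenerate₁₃ F N ↔ θ₀.SlotsNondegenerate₁₃ F N := Iff.rfl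

/-- **THE v1.5 CORE GIVES THE v1.6 CORE AT THE CURED EMBEDDING** (`zrLaws` by FILE 17 `laws_ZrOfRecord₁₃` from the row `zetaUnity`; `zrLocal` by `localLaws_ZrOfRecord₁₃`).
[cite: Balaban1988Convergent, (2.21) p.258, (3.16) p.268, p.267 (bookkeeping)] -/
theorem Stage13Params.Provisos₁₃Core.ofCured {θ₀ : Stage13Params F N} (h : θ₀.Provisos₁₃Core F N) : (Stage13RParams.ofCured F N θ₀).Provisos₁₃CoPR F N :=
  Stage13RParams.provisos₁₃CoPR_of_core (θ := Stage13RParams.ofCured F N θ₀) h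
    (fun p => laws_ZrOfRecord₁₃ (θ := θ₀) (p := p) h.zetaUnity) (fun p => localLaws_ZrOfRecord₁₃ (θ := θ₀) (p := p))

/-- **THE v1.5 SEPARATED-RANGE PROVISOS GIVE THE v1.6 ONES AT THE CURED EMBEDDING.** [cite: Balaban1988Convergent, (2.18) p.257, (2.28) p.259, (3.16) p.268, p.267 (bookkeeping)] -/
theorem Stage13Params.Provisos₁₃SepCoP.ofCured {θ₀ : Stage13Params F N} (h : θ₀.Provisos₁₃SepCoP F N) : (Stage13RParams.ofCured F N θ₀).Provisos₁₃SepCoPR F N :=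
  Stage13RParams.provisos₁₃SepCoPR_of_sepCoP (θ := Stage13RParams.ofCured F N θ₀) h
    (fun p => laws_ZrOfRecord₁₃ (θ := θ₀) (p := p) h.zetaUnity) (fun p => localLaws_ZrOfRecord₁₃ (θ := θ₀) (p := p))

/-- The two projections to the core commute with the cured embedding (`rfl`). [cite: Balaban1988Convergent, (2.21) p.258 (bookkeeping)] -/
theorem Stage13Params.Provisos₁₃SepCoP.ofCured_toCore {θ₀ : Stage13Params F N} (h : θ₀.Provisos₁₃SepCoP F N) : h.ofCured.toCore = h.toCore.ofCured := rfl

end Cured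

/-! ## §3. ★★★ The v1.6 K0 body from the v1.5 one — cured witness; run-blind twin -/

section K0Lift

variable (F : T4Family) {N : ℕ} [NeZero N]

/-- **★★★ THE v1.6 K0 BODY FROM THE v1.5 K0 BODY, AT THE CURED PIN**: a v1.5 inhabitant `θ₀` (provisos `Provisos₁₃SepCoP`, guards `ZtUnity ∧ SlotsNondegenerate₁₃`, admissible) yields the
v1.6 inhabitant `Stage13RParams.ofCured F N θ₀ = ⟨θ₀, ZrOfRecord₁₃ F N θ₀⟩` (provisos by §2, `ZrUnity` hypothesis-free, the other guard and admissibility read `θ₀`; `ZtUnity` is not used).  So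
K0⁶ `Record13SepCoPRInhabited` ⇐ K0⁵ `Record13SepCoPInhabited` by ONE term, with the witness carrying dag-n11-d's cure.  A REDUCTION — nothing of Bałaban asserted. [cite: Balaban1988Convergent, Thm 1 p.262, (1.11) p.248, (2.12) p.256, (2.28) p.259, (3.16)–(3.22) pp.268–269; Balaban1985RegularSpaces, (1.3)–(1.9) p.77; Balaban1985Variational, (6)–(7) p.278, Thm 1 (8)–(10) p.279; Balaban1989LargeFieldI, (0.3)–(0.4) p.176] -/
theorem exists_k0SepCoPR_of_exists_k0SepCoP
    (h : ∃ θ : Stage13Params F N, θ.Provisos₁₃SepCoP F N ∧ (θ.ZtUnity F N ∧ θ.SlotsNondegenerate₁₃ F N) ∧ θ.Admissible F N) :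
    ∃ θ : Stage13RParams F N, θ.Provisos₁₃SepCoPR F N ∧ (θ.ZrUnity F N ∧ θ.SlotsNondegenerate₁₃ F N) ∧ θ.Admissible F N := by
  obtain ⟨θ₀, hP, ⟨_, hS⟩, hA⟩ := h
  exact ⟨Stage13RParams.ofCured F N θ₀, hP.ofCured, ⟨Stage13RParams.zrUnity_ofCured θ₀, hS⟩, hA⟩

/-- **THE RUN-BLIND TWIN** (node00-def-T FILE 25∕26T §R, plan g69 Q4): the same lift along `Stage13RParams.ofRunBlind` (`Zr p := θ₀.Zt p.K`; `ZrUnity` from `ZtUnity`).  It inhabits K0⁶ but is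
NOT the pin of record: at it N11's k = 0 clause still owes the unprinted g₀-uniform matching (dag-n11-d l.19237). [cite: Balaban1988Convergent, Thm 1 p.262, (1.11) p.248, (2.12) p.256, (2.28) p.259, (3.16)–(3.22) pp.268–269; Balaban1985RegularSpaces, (1.3)–(1.9) p.77; Balaban1985Variational, (6)–(7) p.278, Thm 1 (8)–(10) p.279; Balaban1989LargeFieldI, (0.3)–(0.4) p.176] -/
theorem exists_k0SepCoPR_runBlind_of_exists_k0SepCoP
    (h : ∃ θ : Stage13Params F N, θ.Provisos₁₃SepCoP F N ∧ (θ.ZtUnity F N ∧ θ.SlotsNondegenerate₁₃ F N) ∧ θ.Admissible F N) :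
    ∃ θ : Stage13RParams F N, θ.Provisos₁₃SepCoPR F N ∧ (θ.ZrUnity F N ∧ θ.SlotsNondegenerate₁₃ F N) ∧ θ.Admissible F N := by
  obtain ⟨θ₀, hP, ⟨hU, hS⟩, hA⟩ := h
  exact ⟨Stage13RParams.ofRunBlind F N θ₀, hP.ofRunBlind, ⟨hU.ofRunBlind, hS⟩, hA⟩

end K0Lift

end Literature.MathematicalPhysics.QuantumFieldTheory.Balaban1983to89.Node00

end
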